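import Literature.MathematicalPhysics.QuantumFieldTheory.Balaban1983to89.Node00.OpsYLocalInverse
import Literature.MathematicalPhysics.QuantumFieldTheory.Balaban1983to89.B9CubeLettersOpsL0
import Literature.MathematicalPhysics.QuantumFieldTheory.Balaban1983to89.B9Eq326AtOneChart

/-!
# NODE 00 — THE DIRICHLET CUBE INVERSE `G′_□(U) = (Ω₀Δ′_{a,□}(U)Ω₀)⁻¹` OF [B9] p. 394 ∕ pp. 408–409 at def-Y's letters (road P4, `GpDirY`)

[B9] p. 394 L24–33: *"we consider the operator `Δ′_a` with Dirichlet boundary conditions on `∂Ω₀`, i.e. the operator `Δ′_a↾Ω₀ = Ω₀Δ′_aΩ₀`. In the last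
expression `Ω₀` denotes a characteristic function of `Ω₀`. Its inverse is denoted by `G′`, or `G′(U)`. The operators with the boundary conditions have a
very important property. They depend on the configuration `U` restricted to `Ω₀`."*; p. 408 L40 – p. 409 L5: *"Let us take a cube `□ ∈ 𝒟_j` and let us
define a sequence `{Ω_n(□)}_{n=0,…,j+1}` of domains … The operators constructed for this sequence, which we denote by `G′_□(U)`, … satisfy all the
inequalities of Theorems 3.1–3.3 correspondingly."*

THE ROAD OF RECORD P4 (bus I.23150∕WORDS 669; custodian pen on the supplier's D2 CLAIM, I.12344): the print-faithful cube letter has CUBE LEVELS (the sequence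
`{Ω_n(□)}`, r05's `B9CubeLettersOpsL0.deltaPrimeACubeY i q par U = Δ′_{a,□}(U)`) AND DIRICHLET EXTERIOR (`Ω₀(□)`, a site set `S` of def-Y's member torus — the
supplier's reflected box read through its placement; here a BINDER).  FILE 35 (`Node00.OpsYLocalInverse`) built the compression-inverse functor
`dirInvY P T = P (P T P + 1 − P)⁻¹ P` and its law set at the member's levels (`GsqY`); r05 built `GpCubeY = (Δ′_{a,□}(U))⁻¹` on the whole torus.  THIS FILE is the
common refinement `GpDirY i q par S := fun U => dirInvY (cubeProjY i S) (Δ′_{a,□}(U))`, its laws, its locality in `U` (print's «depend on `U` restricted to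
`Ω₀`», support half), the local-inverse identity of (3.87)–(3.88) against the MEMBER's `Δ′_a(U)` for cut-offs supported near □ (r05's row agreement), and THE
`U = 1` CLAUSE in the currency of the supplier's signed-image method (`B4Eq242SignedImages`: compressed identities `A|_{S×S}·K|_{S×S} = 1`):
`G′_□(1) = (𝟙_S K 𝟙_S)♯` for ANY real matrix `K` inverting the compression of the cube matrix `M_□ = mlOpT(cubeFam, wCube)` on `S`.

* §1 (any ring) the two-sided padded identities from compressed ones: `(PTP)(PKP) = P = (PKP)(PTP)` ⇒ `dirPadY P T · dirPadY P K = 1`, `IsUnit (dirPadY P T)`,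
  `(dirPadY P T)⁻¹ = dirPadY P K`, `dirInvY P T = P K P`; (matrices over a commutative ring) the indicator diagonal `indDiagY S = diag 𝟙_S` and the bridge
  from the supplier's `submatrix` identities to `(𝟙_S A 𝟙_S)(𝟙_S K 𝟙_S) = 𝟙_S`.
* §2 `padDeltaCubeY`, ★★ `GpDirY` and the law set (support, vanishing off `S`, dependence on `λ↾S`, `0` off the unit locus, the inverse laws and the LOCAL-INVERSE
  PROPERTY `h Δ′_{a,□}(U) G′_□(U) h = h²` for cut-offs supported in `S`, under `IsUnit (padDeltaCubeY …)` — the regime's positivity, a HYPOTHESIS), the faces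
  `GpDirY i q par univ = GpCubeY i q par`, `padDeltaCubeY … univ U = Δ′_{a,□}(U)`.
* §3 ★★ (3.87)–(3.88) AT THE PRINT LETTER: for a cut-off supported in `S` AND near □ (`NearH`), `h Δ′_a(U) G′_□(U) h = h²` against the MEMBER's `Δ′_a(U)`
  (r05's `deltaPrimeACubeY_apply_eq_of_nearH`), hence `eq388_GpDirY` ∕ `fixedPoint388_GpDirY` ∕ `GpY_eq_fixedPoint388_GpDirY` over any cube-indexed family.
* §4 LOCALITY IN `U`: `Δ′_{a,□}(U)λ(z)` reads `U` at the bonds of `z` and through the block transporters at `z` ⇒ ★ `GpDirY_congr_of_agree`.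
* §5 THE `U = 1` CLAUSE: `cubeProjY i S (f ⊗ E) = (𝟙_S f) ⊗ E`, `padDeltaCubeY i q par S 1 (f ⊗ E) = (dirPadY 𝟙_S M_□ f) ⊗ E`, and — given a real `K` with
  `M_□|_{S×S} K|_{S×S} = 1 = K|_{S×S} M_□|_{S×S}` — `IsUnit (padDeltaCubeY i q par S 1)`, ★★ `GpDirY i q par S 1 = (𝟙_S K 𝟙_S)♯`, its product-form and entry readings.

Exact algebra and bookkeeping only: no estimate, no Cor. 3.6, no choice of `S` (the supplier's D3), no transporter-specific locality.  Gauge group SU(N) only through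
def-Y's carriers; no continuum limit, no OS axioms, no mass gap, no claim on the Clay problem.
-/

namespace Literature.MathematicalPhysics.QuantumFieldTheory.Balaban1983to89.Node00.OpsYCubeDirInverse

open B6KLevelCensusIndexV1 (KIdx)
open B6Cover236MultiLevelBlocks (cubes)
open B6MultiLevelTorusOperator (mlOpT)
open B9Thm37CubeCoverCommutators (cutMulY cutMulY_apply cutMulY_mul KhY eq388_deltaPrimeAY fixedPoint388_deltaPrimeAY)
open B9CubeSequence408 (NearH)
open B9Thm31CubeLocalFlat (wCube)
open B9CubeLettersOpsL0 (cubeFamY levCubeY avgCoeffCubeY avgTrCubeY deltaPrimeACubeY deltaPrimeACubeY_apply deltaPrimeACubeY_apply_eq_of_nearH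
  deltaPrimeACubeY_one_liftY GpCubeY)
open B9Cor35AtOneInverseLetters (eq_liftOpY_of_liftY eq_liftOpY_of_ringInverse isUnit_of_liftY_clause_mulVec liftOpY_mul)
open B9Eq326AtOneChart (liftY_sub)
open OpsYLocalInverse
open scoped Matrix

/-! ## §1 Padded identities from compressed ones (any ring); the indicator diagonal (matrices) -/

section Ring

variable {A : Type} [Ring A] {P : A} (hP : P * P = P)
include hP

/-- `P · dirPadY P K · P = P K P`. [cite: Balaban1985BackgroundPropagators, p.394 («Ω₀Δ′_aΩ₀»), bookkeeping] -/
theorem mul_dirPadY_mul (K : A) : P * dirPadY P K * P = P * K * P := by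
  rw [mul_dirPadY hP, mul_assoc (P * K) P P, hP]

/-- ★ **compressed two-sided identity ⇒ padded product is `1`**: if `(PTP)(PKP) = P` then `dirPadY P T · dirPadY P K = 1`.
[cite: Balaban1985BackgroundPropagators, p.394 («Its inverse is denoted by G′»), (3.25) p.394] -/
theorem dirPadY_mul_dirPadY_eq_one {T K : A} (h : P * T * P * (P * K * P) = P) : dirPadY P T * dirPadY P K = 1 := by
  have h1 : P * T * P * (1 - P) = 0 := by rw [mul_sub, mul_one, mul_assoc (P * T) P P, hP, sub_self]
  have h2 : (1 - P) * (P * K * P) = 0 := by rw [sub_mul, one_mul, ← mul_assoc, ← mul_assoc, hP, sub_self]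
  have h3 : (1 - P) * (1 - P) = (1 : A) - P := by rw [mul_sub, sub_mul, one_mul, mul_one, sub_mul, one_mul, hP, sub_self, sub_zero]
  rw [dirPadY, dirPadY, add_mul, mul_add, mul_add, h, h1, h2, h3, add_zero, zero_add, add_sub_cancel]

/-- hence the padded compression is a unit. [cite: Balaban1985BackgroundPropagators, p.394 («Its inverse is denoted by G′»)] -/
theorem isUnit_dirPadY_of_compr {T K : A} (h₁ : P * T * P * (P * K * P) = P) (h₂ : P * K * P * (P * T * P) = P) : IsUnit (dirPadY P T) :=
  ⟨⟨dirPadY P T, dirPadY P K, dirPadY_mul_dirPadY_eq_one hP h₁, dirPadY_mul_dirPadY_eq_one hP h₂⟩, rfl⟩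

/-- and its inverse is the padded compression of `K`. [cite: Balaban1985BackgroundPropagators, p.394 («Its inverse is denoted by G′»), bookkeeping] -/
theorem ringInverse_dirPadY_of_compr {T K : A} (h₁ : P * T * P * (P * K * P) = P) (h₂ : P * K * P * (P * T * P) = P) :
    Ring.inverse (dirPadY P T) = dirPadY P K :=
  Ring.inverse_unit (⟨dirPadY P T, dirPadY P K, dirPadY_mul_dirPadY_eq_one hP h₁, dirPadY_mul_dirPadY_eq_one hP h₂⟩ : Aˣ)

/-- ★ so the local inverse is `P K P`. [cite: Balaban1985BackgroundPropagators, p.394 («Its inverse is denoted by G′»), (3.25) p.394] -/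
theorem dirInvY_eq_of_compr {T K : A} (h₁ : P * T * P * (P * K * P) = P) (h₂ : P * K * P * (P * T * P) = P) : dirInvY P T = P * K * P := by
  rw [dirInvY, ringInverse_dirPadY_of_compr hP h₁ h₂, mul_dirPadY_mul hP]

end Ring

section IndDiag

variable {Y R : Type} [DecidableEq Y] [CommRing R] (S : Finset Y)

/-- the INDICATOR DIAGONAL `𝟙_S` («`Ω₀` denotes a characteristic function of `Ω₀`») as a matrix. [cite: Balaban1985BackgroundPropagators, p.394 («Ω₀Δ′_aΩ₀»), dictionary] -/
def indDiagY : Matrix Y Y R := Matrix.diagonal fun y => if y ∈ S then 1 else 0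

/-- its entries. [cite: Balaban1985BackgroundPropagators, p.394, bookkeeping] -/
theorem indDiagY_apply (x y : Y) : indDiagY (R := R) S x y = if x = y ∧ x ∈ S then 1 else 0 := by
  rw [indDiagY, Matrix.diagonal_apply]
  by_cases hxy : x = y <;> by_cases hx : x ∈ S <;> simp [hxy, hx]

/-- `𝟙_S` is idempotent. [cite: Balaban1985BackgroundPropagators, p.394, bookkeeping] -/
theorem indDiagY_mul_indDiagY [Fintype Y] : indDiagY (R := R) S * indDiagY S = indDiagY S := by
  rw [indDiagY, Matrix.diagonal_mul_diagonal]
  refine congrArg Matrix.diagonal (funext fun y => ?_)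
  split_ifs <;> simp

/-- `𝟙_S f` is `f` on `S`, `0` off `S`. [cite: Balaban1985BackgroundPropagators, p.394, bookkeeping] -/
theorem indDiagY_mulVec_apply [Fintype Y] (f : Y → R) (x : Y) : (indDiagY (R := R) S *ᵥ f) x = if x ∈ S then f x else 0 := by
  rw [indDiagY, Matrix.mulVec_diagonal]
  split_ifs <;> simp

/-- the entries of a compression `𝟙_S A 𝟙_S`. [cite: Balaban1985BackgroundPropagators, p.394 («Ω₀Δ′_aΩ₀»), bookkeeping] -/
theorem compr_apply [Fintype Y] (A : Matrix Y Y R) (x y : Y) :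
    (indDiagY S * A * indDiagY S : Matrix Y Y R) x y = if x ∈ S ∧ y ∈ S then A x y else 0 := by
  rw [indDiagY, Matrix.mul_diagonal, Matrix.diagonal_mul]
  by_cases hx : x ∈ S <;> by_cases hy : y ∈ S <;> simp [hx, hy]

/-- `(𝟙_S K 𝟙_S) f` at `x`: `Σ_{y∈S} K x y f y` on `S`, `0` off `S`. [cite: Balaban1985BackgroundPropagators, p.394 (the Dirichlet inverse), bookkeeping] -/
theorem compr_mulVec_apply [Fintype Y] (K : Matrix Y Y R) (f : Y → R) (x : Y) :
    ((indDiagY S * K * indDiagY S : Matrix Y Y R) *ᵥ f) x = if x ∈ S then ∑ y ∈ S, K x y * f y else 0 := by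
  simp only [Matrix.mulVec, dotProduct, compr_apply]
  by_cases hx : x ∈ S
  · rw [if_pos hx, ← Finset.sum_filter_add_sum_filter_not Finset.univ (· ∈ S)]
    rw [Finset.filter_mem_eq_inter, Finset.univ_inter, Finset.sum_eq_zero (s := Finset.univ.filter (¬ · ∈ S)), add_zero]
    · exact Finset.sum_congr rfl fun y hy => by rw [if_pos ⟨hx, hy⟩]
    · intro y hy
      rw [Finset.mem_filter] at hy
      rw [if_neg (fun h => hy.2 h.2), zero_mul]
  · rw [if_neg hx]
    exact Finset.sum_eq_zero fun y _ => by rw [if_neg (fun h => hx h.1), zero_mul]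

/-- ★ **THE BRIDGE FROM THE SUPPLIER's COMPRESSED IDENTITY** (`B4Eq242SignedImages.compress_mul_signedImK`'s shape): `A|_{S×S}·K|_{S×S} = 1` on `S`-indexed
matrices gives `(𝟙_S A 𝟙_S)(𝟙_S K 𝟙_S) = 𝟙_S` on the torus. [cite: Balaban1985BackgroundPropagators, p.394 («Its inverse is denoted by G′»); Balaban1983RegularityDecay, (2.42) p.584] -/
theorem compr_mul_compr_eq_indDiagY [Fintype Y] {A K : Matrix Y Y R}
    (h : A.submatrix (fun v : ↥S => (v : Y)) (fun v : ↥S => (v : Y)) * K.submatrix (fun v : ↥S => (v : Y)) (fun v : ↥S => (v : Y)) = 1) :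
    indDiagY S * A * indDiagY S * (indDiagY S * K * indDiagY S) = (indDiagY S : Matrix Y Y R) := by
  ext x y
  rw [Matrix.mul_apply, indDiagY_apply]
  simp only [compr_apply]
  by_cases hx : x ∈ S
  · by_cases hy : y ∈ S
    · have hxy := congrFun (congrFun h ⟨x, hx⟩) ⟨y, hy⟩
      simp only [Matrix.mul_apply, Matrix.submatrix_apply, Matrix.one_apply, Subtype.mk.injEq] at hxy
      rw [← Finset.sum_filter_add_sum_filter_not Finset.univ (· ∈ S), Finset.filter_mem_eq_inter, Finset.univ_inter,
        Finset.sum_eq_zero (s := Finset.univ.filter (¬ · ∈ S)), add_zero, ← Finset.sum_coe_sort S]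
      · rw [show (∑ z : ↥S, (if x ∈ S ∧ (z : Y) ∈ S then A x z else 0) * if (z : Y) ∈ S ∧ y ∈ S then K z y else 0) =
            ∑ z : ↥S, A x z * K z y from Finset.sum_congr rfl fun z _ => by rw [if_pos ⟨hx, z.2⟩, if_pos ⟨z.2, hy⟩], hxy]
        by_cases hxy' : x = y <;> simp [hxy', hy]
      · intro z hz
        rw [Finset.mem_filter] at hz
        rw [if_neg (fun h' => hz.2 h'.2), zero_mul]
    · rw [if_neg (fun h' : x = y ∧ x ∈ S => hy (h'.1 ▸ h'.2))]
      exact Finset.sum_eq_zero fun z _ => by rw [if_neg (fun h' : z ∈ S ∧ y ∈ S => hy h'.2), mul_zero]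
  · rw [if_neg (fun h' => hx h'.2)]
    exact Finset.sum_eq_zero fun z _ => by rw [if_neg (fun h' => hx h'.1), zero_mul]

end IndDiag

/-! ## §2 `G′_□(U)` with cube levels and Dirichlet exterior: the letter and its laws -/

section Letters

variable {𝔸 : Type} [NormedRing 𝔸] [NormedAlgebra ℂ 𝔸] [CompleteSpace 𝔸]
variable {d ℓ : ℕ} {hd : 1 ≤ d + 1} {hL : Odd (ℓ + 1) ∧ 1 < ℓ + 1} {b₀ b₁ : ℝ}
variable (i : KIdx d ℓ hd hL b₀ b₁) (q : ↥(cubes (toKT i).D.toDomains))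

/-- the PADDED COMPRESSION `Ω₀Δ′_{a,□}(U)Ω₀ + (1 − Ω₀)` of the cube-sequence operator to `S = Ω₀(□)` — the regime object whose invertibility is the hypothesis
of every inverse identity below (Thm 3.1 ∕ Cor. 3.6 for the sequence `{Ω_n(□)}`). [cite: Balaban1985BackgroundPropagators, p.394 («Δ′_a↾Ω₀ = Ω₀Δ′_aΩ₀»), pp.408–409, Cor. 3.6 p.408] -/
noncomputable def padDeltaCubeY (par : SiteParY 𝔸 i) (S : Finset (SiteY i)) (U : CfgY 𝔸 i) : Module.End ℂ (SiteY i → 𝔸) :=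
  dirPadY (cubeProjY i S) (deltaPrimeACubeY i q par U)

/-- ★★ **THE DIRICHLET CUBE INVERSE `G′_□(U) = (Ω₀Δ′_{a,□}(U)Ω₀)⁻¹`** of p. 394 ∕ pp. 408–409 for the sequence `{Ω_n(□)}` with `Ω₀(□) = S`: the inverse of r05's
`Δ′_{a,□}(U)` compressed to the functions supported in `S` (Dirichlet data outside), extended by `0` (`Ring.inverse`: `0` off the unit locus).
[cite: Balaban1985BackgroundPropagators, p.394 («Its inverse is denoted by G′, or G′(U)»), pp.408–409 («G′_□(U)»), (3.87) p.409] -/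
noncomputable def GpDirY (par : SiteParY 𝔸 i) (S : Finset (SiteY i)) : SiteOpY 𝔸 i :=
  fun U => dirInvY (cubeProjY i S) (deltaPrimeACubeY i q par U)

/-- `G′_□(U)`, unfolded. [cite: Balaban1985BackgroundPropagators, p.394, bookkeeping] -/
theorem GpDirY_def (par : SiteParY 𝔸 i) (S : Finset (SiteY i)) (U : CfgY 𝔸 i) :
    GpDirY i q par S U = cubeProjY i S * Ring.inverse (padDeltaCubeY i q par S U) * cubeProjY i S := rfl

/-- support on the left: `Ω₀ G′_□ = G′_□`. [cite: Balaban1985BackgroundPropagators, p.394 («Ω₀Δ′_aΩ₀»)] -/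
theorem cubeProjY_mul_GpDirY (par : SiteParY 𝔸 i) (S : Finset (SiteY i)) (U : CfgY 𝔸 i) :
    cubeProjY i S * GpDirY i q par S U = GpDirY i q par S U :=
  mul_dirInvY (cubeProjY_mul_cubeProjY i S) _

/-- and on the right: `G′_□ Ω₀ = G′_□`. [cite: Balaban1985BackgroundPropagators, p.394 («Ω₀Δ′_aΩ₀»)] -/
theorem GpDirY_mul_cubeProjY (par : SiteParY 𝔸 i) (S : Finset (SiteY i)) (U : CfgY 𝔸 i) :
    GpDirY i q par S U * cubeProjY i S = GpDirY i q par S U :=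
  dirInvY_mul (cubeProjY_mul_cubeProjY i S) _

/-- hence `G′_□(U)λ` vanishes off `S`. [cite: Balaban1985BackgroundPropagators, p.394 (Dirichlet boundary conditions)] -/
theorem GpDirY_apply_eq_zero (par : SiteParY 𝔸 i) {S : Finset (SiteY i)} (U : CfgY 𝔸 i) (Λ : SiteY i → 𝔸) {z : SiteY i} (hz : z ∉ S) :
    GpDirY i q par S U Λ z = 0 := by
  rw [← cubeProjY_mul_GpDirY, Module.End.mul_apply, cubeProjY_apply, if_neg hz]

/-- and `G′_□(U)λ` depends on `λ` only on `S`. [cite: Balaban1985BackgroundPropagators, p.394 (Dirichlet boundary conditions)] -/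
theorem GpDirY_apply_congr (par : SiteParY 𝔸 i) {S : Finset (SiteY i)} (U : CfgY 𝔸 i) {Λ Λ' : SiteY i → 𝔸} (h : ∀ z ∈ S, Λ z = Λ' z) :
    GpDirY i q par S U Λ = GpDirY i q par S U Λ' := by
  have hPΛ : cubeProjY (𝔸 := 𝔸) i S Λ = cubeProjY i S Λ' := funext fun z => by
    rw [cubeProjY_apply, cubeProjY_apply]
    split_ifs with hz
    · exact h z hz
    · rfl
  rw [← GpDirY_mul_cubeProjY, Module.End.mul_apply, Module.End.mul_apply, hPΛ]

/-- off the regime (padded compression not a unit) `G′_□(U) = 0`. [cite: Balaban1985BackgroundPropagators, p.394, bookkeeping] -/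
theorem GpDirY_of_not_isUnit (par : SiteParY 𝔸 i) {S : Finset (SiteY i)} {U : CfgY 𝔸 i} (h : ¬ IsUnit (padDeltaCubeY i q par S U)) :
    GpDirY i q par S U = 0 :=
  dirInvY_of_not_isUnit h

/-- ★ **right inverse on the range of `Ω₀`**: `(Ω₀ Δ′_{a,□}(U) Ω₀) G′_□(U) = Ω₀`. [cite: Balaban1985BackgroundPropagators, p.394 («Its inverse is denoted by G′»), (3.25) p.394] -/
theorem compr_deltaPrimeACubeY_mul_GpDirY (par : SiteParY 𝔸 i) {S : Finset (SiteY i)} {U : CfgY 𝔸 i} (hU : IsUnit (padDeltaCubeY i q par S U)) :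
    cubeProjY i S * deltaPrimeACubeY i q par U * cubeProjY i S * GpDirY i q par S U = cubeProjY i S :=
  compr_mul_dirInvY (cubeProjY_mul_cubeProjY i S) hU

/-- ★ **left inverse on the range of `Ω₀`**: `G′_□(U) (Ω₀ Δ′_{a,□}(U) Ω₀) = Ω₀`. [cite: Balaban1985BackgroundPropagators, p.394 («Its inverse is denoted by G′»), (3.25) p.394] -/
theorem GpDirY_mul_compr_deltaPrimeACubeY (par : SiteParY 𝔸 i) {S : Finset (SiteY i)} {U : CfgY 𝔸 i} (hU : IsUnit (padDeltaCubeY i q par S U)) :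
    GpDirY i q par S U * (cubeProjY i S * deltaPrimeACubeY i q par U * cubeProjY i S) = cubeProjY i S :=
  dirInvY_mul_compr (cubeProjY_mul_cubeProjY i S) hU

/-- `Ω₀ Δ′_{a,□}(U) G′_□(U) = Ω₀`. [cite: Balaban1985BackgroundPropagators, p.394, bookkeeping] -/
theorem cubeProjY_mul_deltaPrimeACubeY_mul_GpDirY (par : SiteParY 𝔸 i) {S : Finset (SiteY i)} {U : CfgY 𝔸 i}
    (hU : IsUnit (padDeltaCubeY i q par S U)) :
    cubeProjY i S * deltaPrimeACubeY i q par U * GpDirY i q par S U = cubeProjY i S :=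
  P_mul_T_mul_dirInvY (cubeProjY_mul_cubeProjY i S) hU

/-- ★★ **THE LOCAL-INVERSE PROPERTY against the cube-sequence operator**: for every cut-off `h` supported in `S`, `h Δ′_{a,□}(U) G′_□(U) h = h²`.
[cite: Balaban1985BackgroundPropagators, (3.87)–(3.88) p.409, p.394] -/
theorem cutMulY_deltaPrimeACubeY_GpDirY_cutMulY (par : SiteParY 𝔸 i) {S : Finset (SiteY i)} {U : CfgY 𝔸 i}
    (hU : IsUnit (padDeltaCubeY i q par S U)) (h : SiteY i → ℝ) (hS : ∀ z, h z ≠ 0 → z ∈ S) :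
    cutMulY h * deltaPrimeACubeY i q par U * GpDirY i q par S U * cutMulY h = cutMulY h * cutMulY h := by
  rw [← cutMulY_mul_cubeProjY i h hS, mul_assoc (cutMulY h) (cubeProjY i S) (deltaPrimeACubeY i q par U),
    mul_assoc (cutMulY h) (cubeProjY i S * deltaPrimeACubeY i q par U) (GpDirY i q par S U), cubeProjY_mul_deltaPrimeACubeY_mul_GpDirY i q par hU,
    mul_assoc (cutMulY h) (cubeProjY i S) (cutMulY h * cubeProjY i S), ← mul_assoc (cubeProjY i S) (cutMulY h) (cubeProjY i S),
    cubeProjY_mul_cutMulY i h hS]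

/-- LOCALITY IN `U`, algebraic half: `G′_□(U)` depends on `U` only through the compression `Ω₀ Δ′_{a,□}(U) Ω₀`.
[cite: Balaban1985BackgroundPropagators, p.394 («They depend on the configuration U restricted to Ω₀»)] -/
theorem GpDirY_congr (par : SiteParY 𝔸 i) (S : Finset (SiteY i)) {U U' : CfgY 𝔸 i}
    (h : cubeProjY i S * deltaPrimeACubeY i q par U * cubeProjY i S = cubeProjY i S * deltaPrimeACubeY i q par U' * cubeProjY i S) :
    GpDirY i q par S U = GpDirY i q par S U' :=
  dirInvY_congr h

/-- LOCALITY IN `U`, pointwise form: if `Δ′_{a,□}(U)` and `Δ′_{a,□}(U′)` agree on `S` for every input supported in `S`, then `G′_□(U) = G′_□(U′)`.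
[cite: Balaban1985BackgroundPropagators, p.394 («They depend on the configuration U restricted to Ω₀»)] -/
theorem GpDirY_congr_of_apply (par : SiteParY 𝔸 i) (S : Finset (SiteY i)) {U U' : CfgY 𝔸 i}
    (h : ∀ Λ : SiteY i → 𝔸, (∀ z, z ∉ S → Λ z = 0) → ∀ z ∈ S, deltaPrimeACubeY i q par U Λ z = deltaPrimeACubeY i q par U' Λ z) :
    GpDirY i q par S U = GpDirY i q par S U' :=
  GpDirY_congr i q par S (compr_congr_of_apply i S h)

/-- the padded compression under the same congruence. [cite: Balaban1985BackgroundPropagators, p.394, bookkeeping] -/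
theorem padDeltaCubeY_congr (par : SiteParY 𝔸 i) (S : Finset (SiteY i)) {U U' : CfgY 𝔸 i}
    (h : cubeProjY i S * deltaPrimeACubeY i q par U * cubeProjY i S = cubeProjY i S * deltaPrimeACubeY i q par U' * cubeProjY i S) :
    padDeltaCubeY i q par S U = padDeltaCubeY i q par S U' := by
  rw [padDeltaCubeY, padDeltaCubeY, dirPadY, dirPadY, h]

/-- ★ the whole-torus face: with `S = univ` the Dirichlet cube inverse IS r05's letter `GpCubeY = (Δ′_{a,□}(U))⁻¹`.
[cite: Balaban1985BackgroundPropagators, pp.408–409 («G′_□(U)»), (3.25) p.394] -/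
theorem GpDirY_univ (par : SiteParY 𝔸 i) : GpDirY i q par Finset.univ = GpCubeY i q par := by
  funext U
  rw [GpDirY, cubeProjY_univ, dirInvY_one_left]
  rfl

/-- and its regime object is `Δ′_{a,□}(U)` itself. [cite: Balaban1985BackgroundPropagators, (3.25) p.394, bookkeeping] -/
theorem padDeltaCubeY_univ (par : SiteParY 𝔸 i) (U : CfgY 𝔸 i) : padDeltaCubeY i q par Finset.univ U = deltaPrimeACubeY i q par U := by
  rw [padDeltaCubeY, cubeProjY_univ, dirPadY, one_mul, mul_one, sub_self, add_zero]

/-! ## §3 (3.87)–(3.88) at the print letter: the local inverse against the MEMBER's `Δ′_a(U)` for cut-offs supported near □ -/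

/-- r05's row agreement in operator form: for a cut-off `h` supported near □, `h Δ′_{a,□}(U) = h Δ′_a(U)`. [cite: Balaban1985BackgroundPropagators, (3.88) p.409, (3.24) p.394] -/
theorem cutMulY_mul_deltaPrimeACubeY_eq (par : SiteParY 𝔸 i) (U : CfgY 𝔸 i) (h : SiteY i → ℝ) (hh : ∀ z, h z ≠ 0 → NearH q z.1) :
    cutMulY h * deltaPrimeACubeY i q par U = cutMulY h * deltaPrimeAY i par U := by
  refine LinearMap.ext fun Λ => funext fun z => ?_
  rw [Module.End.mul_apply, Module.End.mul_apply, cutMulY_apply, cutMulY_apply]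
  by_cases hz : h z = 0
  · rw [hz, Complex.ofReal_zero, zero_smul, zero_smul]
  · rw [deltaPrimeACubeY_apply_eq_of_nearH i q par U Λ (hh z hz)]

/-- ★★ **THE `hloc` INPUT OF (3.88) AT THE PRINT LETTER**: for a cut-off supported in `S` and near □ (e.g. `h_□` of (3.87), `supp h_□ ⊂ □̃ ⊂ Ω₀(□)`),
`h Δ′_a(U) G′_□(U) h = h²` against the MEMBER's `Δ′_a(U)`. [cite: Balaban1985BackgroundPropagators, (3.87)–(3.88) p.409, pp.408–409] -/
theorem cutMulY_deltaPrimeAY_GpDirY_cutMulY (par : SiteParY 𝔸 i) {S : Finset (SiteY i)} {U : CfgY 𝔸 i}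
    (hU : IsUnit (padDeltaCubeY i q par S U)) (h : SiteY i → ℝ) (hS : ∀ z, h z ≠ 0 → z ∈ S) (hh : ∀ z, h z ≠ 0 → NearH q z.1) :
    cutMulY h * deltaPrimeAY i par U * GpDirY i q par S U * cutMulY h = cutMulY h * cutMulY h := by
  rw [← cutMulY_mul_deltaPrimeACubeY_eq i q par U h hh]
  exact cutMulY_deltaPrimeACubeY_GpDirY_cutMulY i q par hU h hS

variable {i} in
/-- ★ **(3.88) AT THE PRINT LETTERS**: `Δ′_a(U) G′₀ = 1 − Σ_c K(h_c) G′_{□_c}(U) h_c` with `G′₀ = Σ_c h_c G′_{□_c}(U) h_c` over any cube-indexed real family with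
`Σ_c h_c² = 1`, `h_c` supported in `S_c` and near `□_c`, every padded compression a unit. [cite: Balaban1985BackgroundPropagators, (3.87)–(3.88) p.409] -/
theorem eq388_GpDirY (par : SiteParY 𝔸 i) (U : CfgY 𝔸 i) {ι : Type} [Fintype ι] (qf : ι → ↥(cubes (toKT i).D.toDomains))
    (hf : ι → SiteY i → ℝ) (hsq : ∀ z, ∑ c, hf c z ^ 2 = 1) (S : ι → Finset (SiteY i)) (hS : ∀ c z, hf c z ≠ 0 → z ∈ S c)
    (hh : ∀ c z, hf c z ≠ 0 → NearH (qf c) z.1) (hU : ∀ c, IsUnit (padDeltaCubeY i (qf c) par (S c) U)) :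
    deltaPrimeAY i par U * (∑ c, cutMulY (hf c) * GpDirY i (qf c) par (S c) U * cutMulY (hf c))
      = 1 - ∑ c, KhY i par (hf c) U * GpDirY i (qf c) par (S c) U * cutMulY (hf c) :=
  eq388_deltaPrimeAY i par U hf hsq (fun c => GpDirY i (qf c) par (S c) U)
    fun c => cutMulY_deltaPrimeAY_GpDirY_cutMulY i (qf c) par (hU c) (hf c) (hS c) (hh c)

variable {i} in
/-- ★ **(3.90) AS A FIXED POINT AT THE PRINT LETTERS**: any left inverse `G′` of `Δ′_a(U)` equals `G′₀ + G′ R′`, `R′ = Σ_c K(h_c) G′_{□_c}(U) h_c`.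
[cite: Balaban1985BackgroundPropagators, (3.90) p.409] -/
theorem fixedPoint388_GpDirY (par : SiteParY 𝔸 i) (U : CfgY 𝔸 i) {ι : Type} [Fintype ι] (qf : ι → ↥(cubes (toKT i).D.toDomains))
    (hf : ι → SiteY i → ℝ) (hsq : ∀ z, ∑ c, hf c z ^ 2 = 1) (S : ι → Finset (SiteY i)) (hS : ∀ c z, hf c z ≠ 0 → z ∈ S c)
    (hh : ∀ c z, hf c z ≠ 0 → NearH (qf c) z.1) (hU : ∀ c, IsUnit (padDeltaCubeY i (qf c) par (S c) U))
    {G' : Module.End ℂ (SiteY i → 𝔸)} (hinv : G' * deltaPrimeAY i par U = 1) :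
    G' = (∑ c, cutMulY (hf c) * GpDirY i (qf c) par (S c) U * cutMulY (hf c)) +
      G' * ∑ c, KhY i par (hf c) U * GpDirY i (qf c) par (S c) U * cutMulY (hf c) :=
  fixedPoint388_deltaPrimeAY i par U hf hsq (fun c => GpDirY i (qf c) par (S c) U)
    (fun c => cutMulY_deltaPrimeAY_GpDirY_cutMulY i (qf c) par (hU c) (hf c) (hS c) (hh c)) hinv

variable {i} in
/-- in particular for def-Y's genuine `G′(U) = GpY` wherever `Δ′_a(U)` is invertible. [cite: Balaban1985BackgroundPropagators, (3.90) p.409, (3.25) p.394] -/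
theorem GpY_eq_fixedPoint388_GpDirY (par : SiteParY 𝔸 i) (U : CfgY 𝔸 i) {ι : Type} [Fintype ι] (qf : ι → ↥(cubes (toKT i).D.toDomains))
    (hf : ι → SiteY i → ℝ) (hsq : ∀ z, ∑ c, hf c z ^ 2 = 1) (S : ι → Finset (SiteY i)) (hS : ∀ c z, hf c z ≠ 0 → z ∈ S c)
    (hh : ∀ c z, hf c z ≠ 0 → NearH (qf c) z.1) (hU : ∀ c, IsUnit (padDeltaCubeY i (qf c) par (S c) U)) (hUg : IsUnit (deltaPrimeAY i par U)) :
    GpY i par U = (∑ c, cutMulY (hf c) * GpDirY i (qf c) par (S c) U * cutMulY (hf c)) +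
      GpY i par U * ∑ c, KhY i par (hf c) U * GpDirY i (qf c) par (S c) U * cutMulY (hf c) :=
  fixedPoint388_GpDirY par U qf hf hsq S hS hh hU (GpY_mul_deltaPrimeAY i par U hUg)

/-! ## §4 Locality in `U` — the support half -/

/-- ★ **`Δ′_{a,□}(U)` at `z` reads `U` only at the bonds of `z` and through the transporters `U(Γ_{z,c})U(Γ_{c,w})` of the `L^{lev_□ z}`-block of `z`**.
[cite: Balaban1985BackgroundPropagators, (3.24) p.394, (3.19) p.393, p.409] -/
theorem deltaPrimeACubeY_apply_congr_of_agree (par : SiteParY 𝔸 i) {U U' : CfgY 𝔸 i} (Λ : SiteY i → 𝔸) (z : SiteY i)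
    (hU : ∀ μ, UboxY i U μ z = UboxY i U' μ z ∧ UboxY i U μ ((shiftY i μ).symm z) = UboxY i U' μ ((shiftY i μ).symm z))
    (hpar : ∀ w, avgCoeffCubeY i q z w ≠ 0 → avgTrCubeY i q par U z w = avgTrCubeY i q par U' z w) :
    deltaPrimeACubeY i q par U Λ z = deltaPrimeACubeY i q par U' Λ z := by
  rw [deltaPrimeACubeY_apply, deltaPrimeACubeY_apply, lapS_congr_of_agree i Λ z hU]
  congr 1
  refine Finset.sum_congr rfl fun w _ => ?_
  by_cases hw : avgCoeffCubeY i q z w = 0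
  · rw [hw, Complex.ofReal_zero, zero_smul, zero_smul]
  · rw [hpar w hw]

/-- ★ **PRINT's «they depend on the configuration `U` restricted to `Ω₀`» (support half)**: if `U` and `U′` agree on the bonds at the sites of `S` and their block
transporters agree on the averaging pairs issuing from `S`, then `G′_□(U) = G′_□(U′)` (the transporter clause is the letter `par`'s own locality, discharged on the
junction side). [cite: Balaban1985BackgroundPropagators, p.394 («They depend on the configuration U restricted to Ω₀»), p.410 L14–15] -/
theorem GpDirY_congr_of_agree (par : SiteParY 𝔸 i) (S : Finset (SiteY i)) {U U' : CfgY 𝔸 i}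
    (hU : ∀ z ∈ S, ∀ μ, UboxY i U μ z = UboxY i U' μ z ∧ UboxY i U μ ((shiftY i μ).symm z) = UboxY i U' μ ((shiftY i μ).symm z))
    (hpar : ∀ z ∈ S, ∀ w, avgCoeffCubeY i q z w ≠ 0 → avgTrCubeY i q par U z w = avgTrCubeY i q par U' z w) :
    GpDirY i q par S U = GpDirY i q par S U' :=
  GpDirY_congr_of_apply i q par S fun Λ _ z hz => deltaPrimeACubeY_apply_congr_of_agree i q par Λ z (hU z hz) (hpar z hz)

/-- and the regime object is local in the same sense. [cite: Balaban1985BackgroundPropagators, p.394, bookkeeping] -/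
theorem padDeltaCubeY_congr_of_agree (par : SiteParY 𝔸 i) (S : Finset (SiteY i)) {U U' : CfgY 𝔸 i}
    (hU : ∀ z ∈ S, ∀ μ, UboxY i U μ z = UboxY i U' μ z ∧ UboxY i U μ ((shiftY i μ).symm z) = UboxY i U' μ ((shiftY i μ).symm z))
    (hpar : ∀ z ∈ S, ∀ w, avgCoeffCubeY i q z w ≠ 0 → avgTrCubeY i q par U z w = avgTrCubeY i q par U' z w) :
    padDeltaCubeY i q par S U = padDeltaCubeY i q par S U' :=
  padDeltaCubeY_congr i q par S
    (compr_congr_of_apply i S fun Λ _ z hz => deltaPrimeACubeY_apply_congr_of_agree i q par Λ z (hU z hz) (hpar z hz))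

/-! ## §5 The `U = 1` clause in the supplier's signed-image currency -/

omit [CompleteSpace 𝔸] in
/-- the projection on product-form arguments: `Ω₀(f ⊗ E) = (𝟙_S f) ⊗ E`. [cite: Balaban1985BackgroundPropagators, p.394 («Ω₀ denotes a characteristic function»), bookkeeping] -/
theorem cubeProjY_liftY (S : Finset (SiteY i)) (f : SiteY i → ℝ) (E : 𝔸) :
    cubeProjY i S (liftY f E) = liftY (indDiagY S *ᵥ f) E := by
  funext z
  rw [cubeProjY_apply, liftY_apply, liftY_apply, indDiagY_mulVec_apply]
  split_ifs <;> simp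

omit [CompleteSpace 𝔸] in
/-- so `Ω₀` IS the lift of `𝟙_S`. [cite: Balaban1985BackgroundPropagators, p.394, bookkeeping] -/
theorem cubeProjY_eq_liftOpY (S : Finset (SiteY i)) : cubeProjY (𝔸 := 𝔸) i S = liftOpY 𝔸 (indDiagY S) :=
  eq_liftOpY_of_liftY (cubeProjY_liftY i S)

/-- ★ **the padded compression at `U = 1` on product-form arguments**: `(Ω₀Δ′_{a,□}(1)Ω₀ + 1 − Ω₀)(f ⊗ E) = (dirPadY 𝟙_S M_□ f) ⊗ E`, `M_□` the [4]-matrix of the cube family.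
[cite: Balaban1985BackgroundPropagators, p.395 («It coincides with Δ_a … if U = 1»), p.394; Balaban1984PropagatorsII, (2.13)–(2.14) p.225] -/
theorem padDeltaCubeY_one_liftY (par : SiteParY 𝔸 i) (hpar : ∀ z w, par (fun _ _ => 1) z w = 1) (S : Finset (SiteY i)) (f : SiteY i → ℝ) (E : 𝔸) :
    padDeltaCubeY i q par S (fun _ _ => 1) (liftY f E) =
      liftY (dirPadY (indDiagY S) (mlOpT (toKT i).NB ℓ (toKT i).k (cubeFamY i q).lev (wCube ℓ)) *ᵥ f) E := by
  rw [padDeltaCubeY, dirPadY, dirPadY, LinearMap.add_apply, LinearMap.sub_apply, Module.End.one_apply, Module.End.mul_apply, Module.End.mul_apply,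
    cubeProjY_liftY, deltaPrimeACubeY_one_liftY i q par hpar, cubeProjY_liftY, ← liftY_sub, ← liftY_add, Matrix.add_mulVec, Matrix.sub_mulVec,
    Matrix.one_mulVec, ← Matrix.mulVec_mulVec, ← Matrix.mulVec_mulVec]

/-- hence the padded compression at `U = 1` IS the lift of the padded matrix. [cite: Balaban1985BackgroundPropagators, p.395, bookkeeping] -/
theorem padDeltaCubeY_one_eq_liftOpY (par : SiteParY 𝔸 i) (hpar : ∀ z w, par (fun _ _ => 1) z w = 1) (S : Finset (SiteY i)) :
    padDeltaCubeY i q par S (fun _ _ => 1) = liftOpY 𝔸 (dirPadY (indDiagY S) (mlOpT (toKT i).NB ℓ (toKT i).k (cubeFamY i q).lev (wCube ℓ))) :=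
  eq_liftOpY_of_liftY (padDeltaCubeY_one_liftY i q par hpar S)

/-- ★ **THE REGIME AT `U = 1` FROM THE SUPPLIER**: a real matrix `K` inverting the compression of `M_□` to `S` makes `padDeltaCubeY i q par S 1` a unit.
[cite: Balaban1985BackgroundPropagators, p.394 («Its inverse is denoted by G′»), Cor. 3.5 p.407; Balaban1983RegularityDecay, (2.42) p.584] -/
theorem isUnit_padDeltaCubeY_one (par : SiteParY 𝔸 i) (hpar : ∀ z w, par (fun _ _ => 1) z w = 1) (S : Finset (SiteY i)) {K : Matrix (SiteY i) (SiteY i) ℝ}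
    (hK : (mlOpT (toKT i).NB ℓ (toKT i).k (cubeFamY i q).lev (wCube ℓ)).submatrix (fun v : ↥S => (v : SiteY i)) (fun v : ↥S => (v : SiteY i)) *
      K.submatrix (fun v : ↥S => (v : SiteY i)) (fun v : ↥S => (v : SiteY i)) = 1) :
    IsUnit (padDeltaCubeY i q par S (fun _ _ => (1 : 𝔸ˣ))) :=
  isUnit_of_liftY_clause_mulVec
    (isUnit_dirPadY_of_compr (indDiagY_mul_indDiagY S) (compr_mul_compr_eq_indDiagY S hK) (compr_mul_compr_eq_indDiagY S (mul_eq_one_comm.1 hK)))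
    (padDeltaCubeY_one_liftY i q par hpar S)

/-- ★★ **THE `U = 1` CLAUSE FOR `G′_□`** in the supplier's currency: `G′_□(1) = (𝟙_S K 𝟙_S)♯` for ANY real `K` inverting the compression of `M_□` to `S` (one side
suffices: square matrices over `ℝ`; the supplier's signed-image kernel, `B4Eq242SignedImages.inv_compress_eq_signedImK`).
[cite: Balaban1985BackgroundPropagators, p.394 («Its inverse is denoted by G′»), Cor. 3.5 p.407, pp.408–409; Balaban1983RegularityDecay, (2.42) p.584] -/
theorem GpDirY_one_eq_liftOpY (par : SiteParY 𝔸 i) (hpar : ∀ z w, par (fun _ _ => 1) z w = 1) (S : Finset (SiteY i)) {K : Matrix (SiteY i) (SiteY i) ℝ}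
    (hK : (mlOpT (toKT i).NB ℓ (toKT i).k (cubeFamY i q).lev (wCube ℓ)).submatrix (fun v : ↥S => (v : SiteY i)) (fun v : ↥S => (v : SiteY i)) *
      K.submatrix (fun v : ↥S => (v : SiteY i)) (fun v : ↥S => (v : SiteY i)) = 1) :
    GpDirY i q par S (fun _ _ => 1) = liftOpY 𝔸 (indDiagY S * K * indDiagY S) := by
  have hinv : Ring.inverse (padDeltaCubeY i q par S (fun _ _ => (1 : 𝔸ˣ))) = liftOpY 𝔸 (dirPadY (indDiagY S) K) :=
    eq_liftOpY_of_ringInverse rfl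
      (dirPadY_mul_dirPadY_eq_one (indDiagY_mul_indDiagY S) (compr_mul_compr_eq_indDiagY S hK)) (padDeltaCubeY_one_liftY i q par hpar S)
  rw [GpDirY_def, hinv, cubeProjY_eq_liftOpY, Module.End.mul_eq_comp, Module.End.mul_eq_comp, ← liftOpY_mul, ← liftOpY_mul,
    mul_dirPadY_mul (indDiagY_mul_indDiagY S)]

/-- `G′_□(1)(f ⊗ E) = (𝟙_S K 𝟙_S f) ⊗ E`. [cite: Balaban1985BackgroundPropagators, p.394, Cor. 3.5 p.407; Balaban1983RegularityDecay, (2.42) p.584] -/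
theorem GpDirY_one_liftY (par : SiteParY 𝔸 i) (hpar : ∀ z w, par (fun _ _ => 1) z w = 1) (S : Finset (SiteY i)) {K : Matrix (SiteY i) (SiteY i) ℝ}
    (hK : (mlOpT (toKT i).NB ℓ (toKT i).k (cubeFamY i q).lev (wCube ℓ)).submatrix (fun v : ↥S => (v : SiteY i)) (fun v : ↥S => (v : SiteY i)) *
      K.submatrix (fun v : ↥S => (v : SiteY i)) (fun v : ↥S => (v : SiteY i)) = 1)
    (f : SiteY i → ℝ) (E : 𝔸) :
    GpDirY i q par S (fun _ _ => 1) (liftY f E) = liftY ((indDiagY S * K * indDiagY S) *ᵥ f) E := by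
  rw [GpDirY_one_eq_liftOpY i q par hpar S hK, liftOpY_liftY]

/-- ★ **THE DIRICHLET SOLUTION READING**: `G′_□(1)(f ⊗ E)(x) = (Σ_{y∈S} K x y f y) E` for `x ∈ S`, and `0` off `S`.
[cite: Balaban1985BackgroundPropagators, p.394 (the Dirichlet inverse G′); Balaban1983RegularityDecay, (2.42) p.584] -/
theorem GpDirY_one_liftY_apply (par : SiteParY 𝔸 i) (hpar : ∀ z w, par (fun _ _ => 1) z w = 1) (S : Finset (SiteY i))
    {K : Matrix (SiteY i) (SiteY i) ℝ}
    (hK : (mlOpT (toKT i).NB ℓ (toKT i).k (cubeFamY i q).lev (wCube ℓ)).submatrix (fun v : ↥S => (v : SiteY i)) (fun v : ↥S => (v : SiteY i)) *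
      K.submatrix (fun v : ↥S => (v : SiteY i)) (fun v : ↥S => (v : SiteY i)) = 1)
    (f : SiteY i → ℝ) (E : 𝔸) (x : SiteY i) :
    GpDirY i q par S (fun _ _ => 1) (liftY f E) x = if x ∈ S then (((∑ y ∈ S, K x y * f y : ℝ)) : ℂ) • E else 0 := by
  rw [GpDirY_one_liftY i q par hpar S hK, liftY_apply, compr_mulVec_apply]
  split_ifs <;> simp

end Letters

end Literature.MathematicalPhysics.QuantumFieldTheory.Balaban1983to89.Node00.OpsYCubeDirInverse
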